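import Literature.Probability.RandomPlanarGeometry.SAWTriangularStrip
import HarnessLib

/-!
# Slanted columns and the admissible cuts of a self-avoiding walk of a triangular strip

Topic `Literature/Probability/RandomPlanarGeometry` (continues `SAWTriangularStrip.lean` — the row strips
`S_T = {0 ≤ Y ≤ T}` of the triangular lattice `𝕋` in brick coordinates (`brickGraph` on `ℤ²`, steps `(±2,0)`,
`(±1,±1)`), `TriStrip.stripPairs T N` = (starting site, translate) pairs, `TriStrip.stripCount T N = c_N(S_T)`).
Source of the statement served: N. Madras, G. Slade, *The Self-Avoiding Walk* (1993), §8.2, Theorem 8.2.1,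
eq. (8.2.13), p. 269 ("`μ(R[k,T]) < μ(R[k,T+1])`", stated and proved there for the tubes of `ℤ^d` by bridge renewal,
p. 270).  This file is the combinatorial bookkeeping of the lane's INSERTION proof of the triangular-strip analogue
`μ(S_T(𝕋)) < μ(S_{T+1}(𝕋))` (door «TRI-STRIP-STRICT», a-idea-1 gen 17 design `Sketch_G17_R98`, a-p5 gen 8 variant):
the SLANTED COLUMN `i = ⌊(X − Y)/2⌋` of a brick site (in the coordinates `(i, Y)` the six steps of `𝕋` become
`(±1, 0)`, `(0, ±1)`, `±(1, −1)`: the square lattice plus one family of diagonals, and every step changes `i` by at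
most one), and the ADMISSIBLE CUTS of a walk: the integers `c` such that the walk has a site in a slanted column
`≤ c − 1` and a site in a slanted column `≥ c + 2` (room for the four-column slab insertion on both sides).

## Main statements (namespace `Literature.Probability.RandomPlanarGeometry.SAW.TriStrip`, all PROVED)

* `colIdx`, `colIdx_step` (a brick step changes the slanted column by at most one), `cosetBit`,
  `cosetBit_step` (the parity of `X − Y` is kept), `apply_zero_eq` (`X = 2 i + Y + bit`);
* `triCols a υ n` (the slanted columns met), `triCuts a υ n` (the admissible cuts), `mem_triCuts`,
  `card_triCuts_le` (`≤ n`);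
* **`div_le_card_triCuts_add`** — `n / (T+1) ≤ #triCuts + 3` for every pair of `stripPairs T n`
  (pigeonhole: a slanted column holds `T + 1` sites of the strip on the walk's coset).

## Label (lane «pcv-sawmu», lit-2 gen 15 cell of 2026-08-23)

The strict inequality `μ(S_T(𝕋)) < μ(S_{T+1}(𝕋))` served by this file is NEW-IN-WRITING for the triangular lattice, of
a classical type, by a NEW proof route (injective slab insertion, not the printed renewal / transfer-matrix arguments):
strict monotonicity of strip connective constants is printed for `ℤ^d` [cite: MadrasSlade1993, Theorem 8.2.1 (8.2.13), p. 269 and proof p. 270 (ℤ^d tubes; statement shape — the triangular-strip analogue is not printed there)]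
(Hammersley–Whittington 1985, Notes §8.5 p. 278; for `ℤ²` strips also Alm–Janson 1990 via Guttmann–Jensen LNP 775 p. 236)
and for the honeycomb lattice [cite: BeatonBousquetMelouDeGierDuminilCopinGuttmann2014, Proposition 7 (arXiv v5 p. 11: honeycomb strips, y > 0)];
for triangular strips we located no printed statement («𝕋-strip strict inequality: not located in print (lit-2 g15,
2026-08-23; Alm–Janson 1990 not held, acq-10417)»); the lane's proof is a direct injection rather than the printed
renewal argument.
-/

noncomputable section

open Finset Literature.Probability.LatticeModels Literature.Probability.Percolation SimpleGraph

namespace Literature.Probability.RandomPlanarGeometry.SAW.TriStrip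

open HexBW (InStrip stripStarts mem_stripStarts)

/-! ### Slanted columns -/

/-- The SLANTED COLUMN `i = ⌊(X − Y)/2⌋` of a brick site `(X, Y)`. [cite: MadrasSlade1993, §8.2, Theorem 8.2.1 (8.2.13), p. 269 (statement; the slanted-column insertion is the lane's proof)] -/
def colIdx (u : Site 2) : ℤ := (u 0 - u 1) / 2

/-- The coset bit `(X − Y) mod 2` of a brick site (the brick graph is two copies of `𝕋`). [cite: Grimmett2018, §5.5] -/
def cosetBit (u : Site 2) : ℤ := (u 0 - u 1) % 2

/-- `X = 2 i + Y + bit`. [cite: Grimmett2018, §5.5] -/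
theorem apply_zero_eq (u : Site 2) : u 0 = 2 * colIdx u + u 1 + cosetBit u := by
  unfold colIdx cosetBit; omega

/-- The coset bit is `0` or `1`. [cite: Grimmett2018, §5.5] -/
theorem cosetBit_nonneg_le (u : Site 2) : 0 ≤ cosetBit u ∧ cosetBit u ≤ 1 := by
  unfold cosetBit; omega

/-- A brick step changes the slanted column by at most one. [cite: Grimmett2018, §5.5] -/
theorem colIdx_step {u w : Site 2} (h : brickGraph.Adj u w) :
    colIdx w ≤ colIdx u + 1 ∧ colIdx u ≤ colIdx w + 1 := by
  rw [brickGraph_adj_iff] at h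
  unfold colIdx; omega

/-- A brick step keeps the coset bit. [cite: Grimmett2018, §5.5] -/
theorem cosetBit_step {u w : Site 2} (h : brickGraph.Adj u w) : cosetBit w = cosetBit u := by
  rw [brickGraph_adj_iff] at h
  unfold cosetBit; omega

/-- Two sites with the same slanted column, row and coset bit are equal. [cite: Grimmett2018, §5.5] -/
theorem eq_of_colIdx_eq {u w : Site 2} (hc : colIdx u = colIdx w) (hr : u 1 = w 1)
    (hb : cosetBit u = cosetBit w) : u = w := by
  have h0 : u 0 = w 0 := by rw [apply_zero_eq u, apply_zero_eq w, hc, hr, hb]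
  funext i; fin_cases i
  · exact h0
  · exact hr

/-! ### The columns met and the admissible cuts of a placed walk -/

/-- The slanted columns met by the placed walk `t ↦ a + υ t`, `t ≤ n`. [cite: MadrasSlade1993, §8.2, Theorem 8.2.1 (8.2.13), p. 269] -/
def triCols (a : Site 2) (υ : ℕ → Site 2) (n : ℕ) : Finset ℤ :=
  (Finset.range (n + 1)).image fun t => colIdx (a + υ t)

/-- The columns met form a nonempty set. [cite: MadrasSlade1993, §8.2] -/
theorem triCols_nonempty (a : Site 2) (υ : ℕ → Site 2) (n : ℕ) : (triCols a υ n).Nonempty :=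
  ⟨colIdx (a + υ 0), mem_image.2 ⟨0, by simp, rfl⟩⟩

/-- Membership in `triCols`. [cite: MadrasSlade1993, §8.2] -/
theorem mem_triCols {a : Site 2} {υ : ℕ → Site 2} {n : ℕ} {i : ℤ} :
    i ∈ triCols a υ n ↔ ∃ t ≤ n, colIdx (a + υ t) = i := by
  simp only [triCols, mem_image, mem_range, Nat.lt_succ_iff]

/-- The ADMISSIBLE CUTS of the placed walk: the `c` with a walk site in a slanted column `≤ c − 1` and one in a
slanted column `≥ c + 2`, i.e. the integer interval `[min + 1, max − 2]` of the columns met.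
[cite: MadrasSlade1993, §8.2, Theorem 8.2.1 (8.2.13), p. 269 (statement; the slanted-column insertion is the lane's proof)] -/
def triCuts (a : Site 2) (υ : ℕ → Site 2) (n : ℕ) : Finset ℤ :=
  Finset.Icc ((triCols a υ n).min' (triCols_nonempty a υ n) + 1)
    ((triCols a υ n).max' (triCols_nonempty a υ n) - 2)

/-- **Membership in `triCuts`**: a site in a column `≤ c − 1` and a site in a column `≥ c + 2`.
[cite: MadrasSlade1993, §8.2, Theorem 8.2.1 (8.2.13), p. 269] -/
theorem mem_triCuts {a : Site 2} {υ : ℕ → Site 2} {n : ℕ} {c : ℤ} :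
    c ∈ triCuts a υ n ↔ (∃ t ≤ n, colIdx (a + υ t) ≤ c - 1) ∧ (∃ t ≤ n, c + 2 ≤ colIdx (a + υ t)) := by
  rw [triCuts, Finset.mem_Icc]
  constructor
  · rintro ⟨h1, h2⟩
    obtain ⟨t, ht, hte⟩ := mem_triCols.1 (Finset.min'_mem _ (triCols_nonempty a υ n))
    obtain ⟨t', ht', hte'⟩ := mem_triCols.1 (Finset.max'_mem _ (triCols_nonempty a υ n))
    exact ⟨⟨t, ht, by rw [hte]; omega⟩, ⟨t', ht', by rw [hte']; omega⟩⟩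
  · rintro ⟨⟨t, ht, hte⟩, ⟨t', ht', hte'⟩⟩
    have h1 := Finset.min'_le (triCols a υ n) _ (mem_triCols.2 ⟨t, ht, rfl⟩)
    have h2 := Finset.le_max' (triCols a υ n) _ (mem_triCols.2 ⟨t', ht', rfl⟩)
    exact ⟨by omega, by omega⟩

section StripWalk

variable {T n : ℕ} {a : Site 2} {υ : ℕ → Site 2}

/-- Consecutive slanted columns of a placed walk of `stripPairs` differ by at most one. [cite: Grimmett2018, §5.5] -/
theorem colIdx_step_of_mem (hp : (a, υ) ∈ stripPairs T n) {t : ℕ} (ht : t < n) :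
    colIdx (a + υ (t + 1)) ≤ colIdx (a + υ t) + 1 ∧ colIdx (a + υ t) ≤ colIdx (a + υ (t + 1)) + 1 := by
  obtain ⟨-, hυ, -⟩ := mem_stripPairs.1 hp
  obtain ⟨-, -, hadj, -⟩ := mem_brickSaws.1 hυ
  have h := hadj t ht
  rw [← brickGraph_adj_add_right (υ t) (υ (t + 1)) a, add_comm (υ t), add_comm (υ (t + 1))] at h
  exact colIdx_step h

/-- The slanted columns at two times differ by at most the time elapsed. [cite: Grimmett2018, §5.5] -/
theorem colIdx_sub_le (hp : (a, υ) ∈ stripPairs T n) :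
    ∀ s' ≤ n, ∀ s ≤ s', colIdx (a + υ s') ≤ colIdx (a + υ s) + (s' - s : ℕ) ∧
      colIdx (a + υ s) ≤ colIdx (a + υ s') + (s' - s : ℕ)
  | 0, _, s, hs => by
    have : s = 0 := by omega
    subst this; simp
  | s' + 1, hs', s, hs => by
    rcases Nat.lt_or_ge s (s' + 1) with h | h
    · have ih := colIdx_sub_le hp s' (by omega) s (by omega)
      have hst := colIdx_step_of_mem hp (t := s') (by omega)
      have e : (s' + 1 - s : ℕ) = (s' - s : ℕ) + 1 := by omega
      rw [e]; push_cast; omega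
    · have : s = s' + 1 := by omega
      subst this; simp

/-- **`#triCuts ≤ n`** (the columns met span at most `n + 1` columns). [cite: MadrasSlade1993, §8.2] -/
theorem card_triCuts_le (hp : (a, υ) ∈ stripPairs T n) : (triCuts a υ n).card ≤ n := by
  obtain ⟨t, ht, hte⟩ := mem_triCols.1 (Finset.min'_mem _ (triCols_nonempty a υ n))
  obtain ⟨t', ht', hte'⟩ := mem_triCols.1 (Finset.max'_mem _ (triCols_nonempty a υ n))
  have key : (triCols a υ n).max' (triCols_nonempty a υ n) - (triCols a υ n).min' (triCols_nonempty a υ n) ≤ n := by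
    rcases le_total t t' with h | h
    · have := (colIdx_sub_le hp t' ht' t h).1
      rw [hte, hte'] at this
      have : ((t' - t : ℕ) : ℤ) ≤ n := by exact_mod_cast (show t' - t ≤ n by omega)
      omega
    · have := (colIdx_sub_le hp t ht t' h).2
      rw [hte, hte'] at this
      have : ((t - t' : ℕ) : ℤ) ≤ n := by exact_mod_cast (show t - t' ≤ n by omega)
      omega
  rw [triCuts, Int.card_Icc]
  omega

/-- The coset bit is constant along a placed walk. [cite: Grimmett2018, §5.5] -/
theorem cosetBit_eq_of_mem (hp : (a, υ) ∈ stripPairs T n) : ∀ t ≤ n, cosetBit (a + υ t) = cosetBit (a + υ 0)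
  | 0, _ => rfl
  | t + 1, ht => by
    obtain ⟨-, hυ, -⟩ := mem_stripPairs.1 hp
    obtain ⟨-, -, hadj, -⟩ := mem_brickSaws.1 hυ
    have h := hadj t (by omega)
    rw [← brickGraph_adj_add_right (υ t) (υ (t + 1)) a, add_comm (υ t), add_comm (υ (t + 1))] at h
    rw [cosetBit_step h, cosetBit_eq_of_mem hp t (by omega)]

/-- The columns met lie between the leftmost and the rightmost one: `#triCols ≤ max − min + 1`.
[cite: MadrasSlade1993, §8.2] -/
theorem card_triCols_le (a : Site 2) (υ : ℕ → Site 2) (n : ℕ) :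
    ((triCols a υ n).card : ℤ) ≤
      (triCols a υ n).max' (triCols_nonempty a υ n) - (triCols a υ n).min' (triCols_nonempty a υ n) + 1 := by
  have hsub : triCols a υ n ⊆ Finset.Icc ((triCols a υ n).min' (triCols_nonempty a υ n))
      ((triCols a υ n).max' (triCols_nonempty a υ n)) := fun c hc =>
    Finset.mem_Icc.2 ⟨Finset.min'_le _ _ hc, Finset.le_max' _ _ hc⟩
  have h := Finset.card_le_card hsub
  rw [Int.card_Icc] at h
  have : (((triCols a υ n).max' (triCols_nonempty a υ n) + 1 - (triCols a υ n).min' (triCols_nonempty a υ n)).toNat : ℤ) =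
      (triCols a υ n).max' (triCols_nonempty a υ n) + 1 - (triCols a υ n).min' (triCols_nonempty a υ n) :=
    Int.toNat_of_nonneg (by linarith [Finset.min'_le (triCols a υ n) _ (Finset.max'_mem _ (triCols_nonempty a υ n))])
  have h' : ((triCols a υ n).card : ℤ) ≤ (((triCols a υ n).max' (triCols_nonempty a υ n) + 1 -
      (triCols a υ n).min' (triCols_nonempty a υ n)).toNat : ℤ) := by exact_mod_cast h
  linarith

/-- **Pigeonhole**: the `n + 1` distinct sites of the walk lie in `#triCols` slanted columns of `T + 1` sites each
(on the walk's coset a site is determined by its slanted column and its row): `n + 1 ≤ #triCols · (T+1)`.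
[cite: MadrasSlade1993, §8.2, Theorem 8.2.1 (8.2.13), p. 269] -/
theorem succ_le_card_triCols_mul (hp : (a, υ) ∈ stripPairs T n) : n + 1 ≤ (triCols a υ n).card * (T + 1) := by
  obtain ⟨-, hυ, hR⟩ := mem_stripPairs.1 hp
  dsimp only at hR
  obtain ⟨-, -, -, hinj⟩ := mem_brickSaws.1 hυ
  have h := Finset.card_le_card_of_injOn (s := Finset.range (n + 1)) (t := triCols a υ n ×ˢ Finset.range (T + 1))
    (fun t => (colIdx (a + υ t), ((a + υ t) 1).toNat)) (fun t ht => ?_) (fun t ht t' ht' h => ?_)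
  · simpa using h
  · have ht' : t ≤ n := by simpa [Nat.lt_succ_iff] using ht
    simp only [Finset.coe_product, Finset.coe_range, Set.mem_prod, Finset.mem_coe, Set.mem_Iio]
    refine ⟨mem_triCols.2 ⟨t, ht', rfl⟩, ?_⟩
    have h1 := (hR t ht').1; have h2 := (hR t ht').2; omega
  · have htn : t ≤ n := by simpa [Nat.lt_succ_iff] using ht
    have htn' : t' ≤ n := by simpa [Nat.lt_succ_iff] using ht'
    simp only [Prod.mk.injEq] at h
    have h0 := (hR t htn).1; have h0' := (hR t' htn').1
    have e1 : (a + υ t) 1 = (a + υ t') 1 := by omega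
    have eb : cosetBit (a + υ t) = cosetBit (a + υ t') := by
      rw [cosetBit_eq_of_mem hp t htn, cosetBit_eq_of_mem hp t' htn']
    have e : υ t = υ t' := add_left_cancel (eq_of_colIdx_eq h.1 e1 eb)
    exact hinj htn htn' e

/-- **Every `n`-step walk of the strip `S_T` of `𝕋` has at least `n / (T+1) − 3` admissible cuts**:
`n / (T+1) ≤ #triCuts + 3`. [cite: MadrasSlade1993, §8.2, Theorem 8.2.1 (8.2.13), p. 269] -/
theorem div_le_card_triCuts_add (hp : (a, υ) ∈ stripPairs T n) : n / (T + 1) ≤ (triCuts a υ n).card + 3 := by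
  have h2 := card_triCols_le a υ n
  have h3 := succ_le_card_triCols_mul hp
  have h4 : n / (T + 1) < (triCols a υ n).card := by
    by_contra h
    have : (triCols a υ n).card * (T + 1) ≤ n / (T + 1) * (T + 1) := Nat.mul_le_mul_right _ (not_lt.1 h)
    have h5 : n / (T + 1) * (T + 1) ≤ n := Nat.div_mul_le_self n (T + 1)
    omega
  have h6 : ((triCols a υ n).card : ℤ) ≤ ((triCuts a υ n).card : ℤ) + 3 := by
    rw [triCuts, Int.card_Icc]
    have := Int.self_le_toNat ((triCols a υ n).max' (triCols_nonempty a υ n) - 2 + 1 -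
      ((triCols a υ n).min' (triCols_nonempty a υ n) + 1))
    linarith
  omega

end StripWalk

end Literature.Probability.RandomPlanarGeometry.SAW.TriStrip
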